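import Literature.NumberTheory.ComplexMultiplication.CMTypeUniformizationQMultiplicationDegree
import Literature.NumberTheory.ComplexMultiplication.CMTypeUniformizationToBaseChange
import Literature.NumberTheory.ComplexMultiplication.ReflexTypeNormAbsNorm
import Literature.NumberTheory.ComplexMultiplication.ShimuraTaniyamaPairDegOne
import Literature.AlgebraicGeometry.Motives.AbelianVarietyGoodReductionHomSurjective
import Literature.AlgebraicGeometry.Motives.AbelianVarietyGoodReductionHomDegree
import HarnessLib

/-!
# The reduction of the `𝔮`-multiplication is an isogeny of degree `pⁿ`
# (Shimura 1998, §18.6, proof of Thm. 18.6, p. 127: «`ν(λ̃) = ν(λ) = N(𝔮) = pⁿ`»; §11.1 Prop. 12; §7.1 Prop. 7)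

Topic `Literature/NumberTheory/ComplexMultiplication`, namespace `Literature.NumberTheory.ComplexMultiplication`.
KERNEL ONLY: one theorem; no definition, no named fact, no `sorry`.

In the binders of the cell's named fact `shimuraTaniyamaPair_degOne'` (row II-1-S2₁′; cell `hodgecm-mathlib`, E2
«height-one road», A-p02's ASM skeleton v2 `fa4b0724`, stub `stub_degree` VERBATIM): for `(A, ι_A)` of type
`(K, Φ, 𝔞)` w.r.t. `ξ`, `(B, ι_B)` of type `(K, Φ, 𝔟)` w.r.t. `η`, `𝔮𝔟 = 𝔞`, the `𝔮`-multiplication `λ : A → B`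
(`λ(ξ.r u) = η.r u`), a prime `𝔭` of `K*` with `N(𝔭) = p`, `𝔮 = g(𝔭)`, and good-reduction data `R`, `S`, `H` at
`𝔓 ∣ 𝔭`: **the reduction `λ̃ = H.redHom λ` is an isogeny with `deg λ̃ = Hom.kerRank λ̃ = p ^ dim Ã`.**

Assembly of landed leaves (all theorems of the tree):
* A-p16 `CMTypeUniformization.exists_baseChange_map_baseChange_r_eq` — the `k`-shape uniformisations `ξ`, `η` and
  `λ(ξ.r u) = η.r u` lift to base-change-shape `ξ′`, `η′` with `(λ ⊗ ℂ)(ξ′.r u) = η′.r u`;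
* B-p17 `CMTypeUniformization.isIsogeny_of_map_baseChange_r_eq'`, `…kerRank_eq_absNorm_of_map_baseChange_r_eq` —
  `λ` is an isogeny and `deg λ = N(𝔮)` ([Shimura1998] §7.1 Prop. 7, §7.2 Prop. 10);
* B-p12 `GoodReductionAt.HomReduction.isIsogeny_redHom` — `λ̃` is an isogeny ([Shimura1998] §11.1 Prop. 12);
* B-p05 `GoodReductionAt.HomReduction.kerRank_redHom_eq` — `deg λ̃ = deg λ` ([Shimura1998] §11.1 Prop. 12 «`ν(λ) = ν(λ̃)`»);
* B-p03 `absNorm_eq_pow_dim_of_isReflexTypeNorm_traceField` — `N(𝔮) = N(g(𝔭)) = p ^ dim A` (p. 127);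
* `GoodReductionAt.dim_reduction` — `dim Ã = dim A`.

## References
* [Shimura1998] G. Shimura, *Abelian Varieties with Complex Multiplication and Modular Functions*, Princeton
  Univ. Press 1998: §18.6, proof of Thm. 18.6, p. 127 (reduction-mod-`𝔓` passage, pp. 127–128); §11.1 Prop. 12 (p. 83);
  §7.1 Prop. 7 (p. 47), §7.2 Prop. 10.
-/

set_option autoImplicit false

noncomputable section

open CategoryTheory IsDedekindDomain NumberField
open scoped NumberField nonZeroDivisors

namespace Literature.NumberTheory.ComplexMultiplication

open Literature.AlgebraicGeometry.Motives
open Literature.AlgebraicGeometry.Motives.AbelianVariety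

/-- **«`ν(λ̃) = ν(λ) = N(𝔮) = pⁿ`»: the reduction of the `𝔮`-multiplication is an isogeny of degree `p ^ dim Ã`**
(the `stub_degree` text of the E2 skeleton, binders = `shimuraTaniyamaPair_degOne'` verbatim).
[cite: Shimura1998, §18.6, proof of Thm. 18.6, p. 127; §11.1 Prop. 12, p. 83; §7.1 Prop. 7, p. 47] -/
theorem isIsogeny_redHom_and_kerRank_eq_of_qMultiplication (K : Type) [Field K] [NumberField K] [IsCMField K]
    (Φ : CMType K) [NumberField (traceField Φ)]
    (k : Type) [Field k] [NumberField k] [Algebra k ℂ] (i₀ : traceField Φ →+* k)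
    (_hi₀ : (algebraMap k ℂ).comp i₀ = algebraMap (traceField Φ) ℂ)
    (𝔞 𝔟 : (FractionalIdeal (𝓞 K)⁰ K)ˣ) (𝔮 : Ideal (𝓞 K))
    (h𝔮𝔟 : (𝔮 : FractionalIdeal (𝓞 K)⁰ K) * (𝔟 : FractionalIdeal (𝓞 K)⁰ K) = 𝔞)
    (A B : AbelianVariety k) (ιA : 𝓞 K →+* End A) (ιB : 𝓞 K →+* End B)
    (ξ : CMTypeUniformization Φ 𝔞 A ιA) (ηB : CMTypeUniformization Φ 𝔟 B ιB)
    (lam : A ⟶ B) (hlam : ∀ u : K, AlgPoints.map lam.hom.hom.hom (ξ.r u) = ηB.r u)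
    (𝔭 : HeightOneSpectrum (𝓞 (traceField Φ))) (𝔓 : HeightOneSpectrum (𝓞 k))
    (_h𝔓 : 𝔓.asIdeal.comap (RingOfIntegers.mapRingHom i₀) = 𝔭.asIdeal)
    (p : ℕ) [ExpChar 𝔓.asIdeal.ResidueField p] (hq : Ideal.absNorm 𝔭.asIdeal = p ^ 1)
    (h𝔮 : ∃ (Lg : Type) (_ : Field Lg) (_ : NumberField Lg) (_ : Normal ℚ Lg) (ιL : Lg →+* ℂ)
        (j : K →+* Lg) (σ₀ : traceField Φ →+* Lg),
        ιL.comp σ₀ = algebraMap (traceField Φ) ℂ ∧ IsReflexTypeNorm (valuedIn ιL Φ.1) j σ₀ 𝔭.asIdeal 𝔮)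
    (R : A.GoodReductionAt 𝔓) (S : B.GoodReductionAt 𝔓) (H : GoodReductionAt.HomReduction R S) :
    IsIsogeny (H.redHom lam) ∧ Hom.kerRank (H.redHom lam) = p ^ R.reduction.dim := by
  -- (F2) base-change-shape uniformisations over `ξ`, `η`, carrying `λ(ξ.r u) = η.r u`
  obtain ⟨ξ', η', -, -, hlam'⟩ :=
    CMTypeUniformization.exists_baseChange_map_baseChange_r_eq ξ ηB lam (1 : K) (fun u => by rw [one_mul]; exact hlam u)
  have hlam'' : ∀ u : K, AlgPoints.map (AbelianVariety.Hom.baseChange ℂ lam).hom.hom.hom (ξ'.r u) = η'.r u :=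
    fun u => by rw [hlam', one_mul]
  -- (d) `λ` is an isogeny of degree `N(𝔮)`
  have hiso : IsIsogeny lam := CMTypeUniformization.isIsogeny_of_map_baseChange_r_eq' ξ' η' 𝔮 h𝔮𝔟 hlam''
  have hdeg : Hom.kerRank lam = Ideal.absNorm 𝔮 :=
    CMTypeUniformization.kerRank_eq_absNorm_of_map_baseChange_r_eq ξ' η' 𝔮 h𝔮𝔟 hlam''
  -- (a) reduction preserves isogenies and their degree
  have hred : IsIsogeny (H.redHom lam) := H.isIsogeny_redHom hiso
  refine ⟨hred, ?_⟩
  rw [H.kerRank_redHom_eq' hiso, hdeg, absNorm_eq_pow_dim_of_isReflexTypeNorm_traceField K Φ ξ 𝔭.asIdeal 𝔮 hq h𝔮,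
    R.dim_reduction]

end Literature.NumberTheory.ComplexMultiplication

end
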